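import Summits.QuantumFields.BalabanUV.T4Continuum.Support.ApproxRefineAssembly
import Summits.QuantumFields.BalabanUV.T4Continuum.Support.ApproxRefineRootData
import Summits.QuantumFields.BalabanUV.T4Continuum.Support.SkeletonFillFullSmallField

/-!
# T⁴ programme, node NE3 — kinematic refinement lemma, row R1-asm, part 3a: THE SMALL-FIELD CLAUSE OF THE FILLING
# DISCHARGED (`hfillS` of `approxRefine_of_fillBounds` from row S4d's `smallField_fullFill` ∘ part 2b's `rootData_precomp`)

NE3 formalisation swarm, LEAF PROVER 09 (unit `b2b-balaban-t4-ne3-formalise-leaf-09`), row **R1-asm**.  Part 2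
(`ApproxRefineAssembly.approxRefine_of_fillBounds`, p212554) delivers the socket `ApproxRefine` modulo two regularity
bounds of the filled pre-compensated configuration `W = fullFill L (precomp L U) (rootH L (precomp L U))`; this file
discharges the FIRST of them, `SmallField W (b₁/(L^{j+1})²)`, with the CLOSED constant
`b₁ = 4(8d−7)b + 48·d·L²·((2d−1)c + gradRem(d)·b²) + 128(2d+1)²L²(8d−7)²b²`, by composing leaf-07's
`SkeletonFillFullSmallField.smallField_fullFill` (radius in the root data `(a₀, δ)`) with part 2b's
`ApproxRefineRootData.rootData_precomp` (root data of `precomp L U` in `(b, c)`), and restates part 2 with only the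
flux-GRADIENT clause `hfillG` left as a hypothesis (`approxRefine_of_gradBound`).  All [folklore]; 0 defs (the
constant is written out in full in the statements); 0 sorry.

HONEST FRAMING.  No printed sentence is a hypothesis; everything imported BY NAME; no `def … : Prop`, no definition, no
`sorry`; axioms ⊆ {propext, Classical.choice, Quot.sound}.  NE3 NOT proved; `ApproxRefine` still CONDITIONAL on the
flux-gradient clause (row S4d F4, face cases pending); spine 0/9; `BetaPertH`, (B), G-an2-4 occur nowhere; finite T⁴ rung
(B)+1 — NOT infinite volume, NOT a mass gap, NOT the Clay problem.  HONEST DEPENDENCY (cell page 1): continuum YM on T⁴ ⇐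
BetaPertH ∧ nine spine estimates (0/9 proved); BetaPertH ⇐ (D1) ∧ (D4) ∧ CAP+tail; G-an2-4 gates asym, D1 and NE2/3/4.
PLACEMENT (human rule 2026-08-19): under `Summits/QuantumFields/BalabanUV/`; imports tree modules only; moves nothing.
-/

set_option autoImplicit false

open scoped BigOperators Matrix Matrix.Norms.L2Operator
open NormedSpace

namespace Summit.QuantumFields.BalabanUV.T4Continuum.ApproxRefineFillSmall

open Literature.MathematicalPhysics.QuantumFieldTheory.Balaban1983to89
open B7Prop1Explicit B7Prop2Explicit MatrixLog UnitaryModel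
open T4AveragingDeficitWall hiding Site Plane Plaq Bond
open MinimalActionRate (sfClass)
open MinimalActionRefine (RegularSup)
open SkeletonFillUnitary (rootH rootCoeff rootCoeff_nonneg rootH_mem_unitary rootH_pow)
open SkeletonFillFull (fullFill)
open SkeletonPrecomp (precomp precompCoeff)
open SkeletonPrecompGrad (gradRem gradRem_nonneg)
open SmoothRefineOfApprox (ApproxRefine)
open ApproxRefineRootData (rootData_precomp)
open ApproxRefineAssembly (approxRefine_of_fillBounds skeletonDatum_precomp_of_regularSup)
open SkeletonFillFullSmallField (smallField_fullFill)

noncomputable section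

variable {d : ℕ} {n : Type*} [Fintype n] [DecidableEq n]

/-! ## §1 Scale bookkeeping (pure real arithmetic) -/

/-- leaf-07's radius `a₀ + 2d(L−1)δ + 2d(L−1)Lδ + 8(d(L−1)a₀ + d(L−1)La₀ + L²a₀)²` at root data
`a₀ = L^{−2}·4(8d−7)b/s²`, `δ = 12·L^{−2}·G₀/s³` (`s = L^j ≥ 1`, `G₀ ≥ 0`) is at most
`(4(8d−7)b + 48dL²G₀ + 128(2d+1)²L²(8d−7)²b²)/(L·s)²`. [folklore] -/
theorem scale_fillS (d L : ℕ) (hL : 1 ≤ L) {s b G₀ : ℝ} (hs : 1 ≤ s) (hb : 0 ≤ (8 * (d : ℝ) - 7) * b) (hG : 0 ≤ G₀) :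
    rootCoeff L * (4 * ((8 * (d : ℝ) - 7) * b / s ^ 2))
      + 2 * (d * ((L - 1 : ℕ) * (12 * rootCoeff L * (G₀ / s ^ 3))))
      + 2 * (d * (((L - 1 : ℕ) * L) * (12 * rootCoeff L * (G₀ / s ^ 3))))
      + 8 * (d * ((L - 1 : ℕ) * (rootCoeff L * (4 * ((8 * (d : ℝ) - 7) * b / s ^ 2))))
          + d * (((L - 1 : ℕ) * L) * (rootCoeff L * (4 * ((8 * (d : ℝ) - 7) * b / s ^ 2))))
          + L * L * (rootCoeff L * (4 * ((8 * (d : ℝ) - 7) * b / s ^ 2)))) ^ 2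
    ≤ (4 * (8 * (d : ℝ) - 7) * b + 48 * d * (L : ℝ) ^ 2 * G₀
        + 128 * (2 * (d : ℝ) + 1) ^ 2 * (L : ℝ) ^ 2 * ((8 * (d : ℝ) - 7) * b) ^ 2) / ((L : ℝ) * s) ^ 2 := by
  have hL1 : (1 : ℝ) ≤ L := by exact_mod_cast hL
  have hL0 : (0 : ℝ) < L := by linarith
  have hs0 : 0 < s := by linarith
  have hLm : ((L - 1 : ℕ) : ℝ) ≤ L := by exact_mod_cast Nat.sub_le L 1
  have hLm0 : (0 : ℝ) ≤ ((L - 1 : ℕ) : ℝ) := by positivity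
  have hd0 : (0 : ℝ) ≤ d := by positivity
  have hrc : rootCoeff L = 1 / (L : ℝ) ^ 2 := by unfold rootCoeff; rw [one_div]
  set A : ℝ := (8 * (d : ℝ) - 7) * b with hAdef
  -- the three groups, each in units of `1/(L s)²`
  set a₀ : ℝ := rootCoeff L * (4 * (A / s ^ 2)) with ha0def
  set δ : ℝ := 12 * rootCoeff L * (G₀ / s ^ 3) with hδdef
  have ha0v : a₀ = 4 * A / ((L : ℝ) * s) ^ 2 := by rw [ha0def, hrc]; field_simp
  have ha00 : 0 ≤ a₀ := by rw [ha0v]; positivity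
  have hδ0 : 0 ≤ δ := by rw [hδdef]; positivity [rootCoeff_nonneg L]
  have hδv : δ ≤ 12 * G₀ / ((L : ℝ) * s) ^ 2 := by
    rw [hδdef, hrc]
    have : G₀ / s ^ 3 ≤ G₀ / s ^ 2 := by
      apply div_le_div_of_nonneg_left hG (by positivity)
      calc s ^ 2 = s ^ 2 * 1 := (mul_one _).symm
        _ ≤ s ^ 2 * s := by gcongr
        _ = s ^ 3 := by ring
    calc 12 * (1 / (L : ℝ) ^ 2) * (G₀ / s ^ 3) ≤ 12 * (1 / (L : ℝ) ^ 2) * (G₀ / s ^ 2) := by gcongr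
      _ = 12 * G₀ / ((L : ℝ) * s) ^ 2 := by field_simp
  -- group 2: the δ terms
  have hg2 : 2 * (d * ((L - 1 : ℕ) * δ)) + 2 * (d * (((L - 1 : ℕ) * L) * δ)) ≤ 48 * d * (L : ℝ) ^ 2 * G₀ / ((L : ℝ) * s) ^ 2 := by
    have h1 : ((L - 1 : ℕ) : ℝ) * δ ≤ (L : ℝ) ^ 2 * δ := by
      apply mul_le_mul_of_nonneg_right _ hδ0; nlinarith
    have h2 : (((L - 1 : ℕ) : ℝ) * L) * δ ≤ (L : ℝ) ^ 2 * δ := by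
      apply mul_le_mul_of_nonneg_right _ hδ0; nlinarith
    calc 2 * (d * ((L - 1 : ℕ) * δ)) + 2 * (d * (((L - 1 : ℕ) * L) * δ))
        ≤ 2 * (d * ((L : ℝ) ^ 2 * δ)) + 2 * (d * ((L : ℝ) ^ 2 * δ)) := by gcongr
      _ = 4 * d * (L : ℝ) ^ 2 * δ := by ring
      _ ≤ 4 * d * (L : ℝ) ^ 2 * (12 * G₀ / ((L : ℝ) * s) ^ 2) := by gcongr
      _ = 48 * d * (L : ℝ) ^ 2 * G₀ / ((L : ℝ) * s) ^ 2 := by ring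
  -- group 3: the square
  have hg3 : 8 * (d * ((L - 1 : ℕ) * a₀) + d * (((L - 1 : ℕ) * L) * a₀) + L * L * a₀) ^ 2
      ≤ 128 * (2 * (d : ℝ) + 1) ^ 2 * (L : ℝ) ^ 2 * A ^ 2 / ((L : ℝ) * s) ^ 2 := by
    have hin : d * ((L - 1 : ℕ) * a₀) + d * (((L - 1 : ℕ) * L) * a₀) + L * L * a₀ ≤ (2 * (d : ℝ) + 1) * (L : ℝ) ^ 2 * a₀ := by
      have h1 : ((L - 1 : ℕ) : ℝ) * a₀ ≤ (L : ℝ) ^ 2 * a₀ := by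
        apply mul_le_mul_of_nonneg_right _ ha00; nlinarith
      have h2 : (((L - 1 : ℕ) : ℝ) * L) * a₀ ≤ (L : ℝ) ^ 2 * a₀ := by
        apply mul_le_mul_of_nonneg_right _ ha00; nlinarith
      calc d * ((L - 1 : ℕ) * a₀) + d * (((L - 1 : ℕ) * L) * a₀) + L * L * a₀
          ≤ d * ((L : ℝ) ^ 2 * a₀) + d * ((L : ℝ) ^ 2 * a₀) + L * L * a₀ := by gcongr
        _ = (2 * (d : ℝ) + 1) * (L : ℝ) ^ 2 * a₀ := by ring
    have hin0 : 0 ≤ d * ((L - 1 : ℕ) * a₀) + d * (((L - 1 : ℕ) * L) * a₀) + L * L * a₀ := by positivity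
    have hsq : (d * ((L - 1 : ℕ) * a₀) + d * (((L - 1 : ℕ) * L) * a₀) + L * L * a₀) ^ 2
        ≤ ((2 * (d : ℝ) + 1) * (L : ℝ) ^ 2 * a₀) ^ 2 := pow_le_pow_left₀ hin0 hin 2
    have ha0sq : ((2 * (d : ℝ) + 1) * (L : ℝ) ^ 2 * a₀) ^ 2 = 16 * (2 * (d : ℝ) + 1) ^ 2 * A ^ 2 / s ^ 4 := by
      rw [ha0v]; field_simp; ring
    have hs4 : 16 * (2 * (d : ℝ) + 1) ^ 2 * A ^ 2 / s ^ 4 ≤ 16 * (2 * (d : ℝ) + 1) ^ 2 * (L : ℝ) ^ 2 * A ^ 2 / ((L : ℝ) * s) ^ 2 := by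
      rw [div_le_div_iff₀ (by positivity) (by positivity)]
      have : ((L : ℝ) * s) ^ 2 ≤ (L : ℝ) ^ 2 * s ^ 4 := by
        rw [mul_pow]; apply mul_le_mul_of_nonneg_left _ (by positivity)
        calc s ^ 2 = s ^ 2 * 1 := (mul_one _).symm
          _ ≤ s ^ 2 * s ^ 2 := by gcongr; exact one_le_pow₀ hs
          _ = s ^ 4 := by ring
      calc 16 * (2 * (d : ℝ) + 1) ^ 2 * A ^ 2 * ((L : ℝ) * s) ^ 2
          ≤ 16 * (2 * (d : ℝ) + 1) ^ 2 * A ^ 2 * ((L : ℝ) ^ 2 * s ^ 4) := by gcongr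
        _ = 16 * (2 * (d : ℝ) + 1) ^ 2 * (L : ℝ) ^ 2 * A ^ 2 * s ^ 4 := by ring
    calc 8 * (d * ((L - 1 : ℕ) * a₀) + d * (((L - 1 : ℕ) * L) * a₀) + L * L * a₀) ^ 2
        ≤ 8 * ((2 * (d : ℝ) + 1) * (L : ℝ) ^ 2 * a₀) ^ 2 := by gcongr
      _ = 8 * (16 * (2 * (d : ℝ) + 1) ^ 2 * A ^ 2 / s ^ 4) := by rw [ha0sq]
      _ ≤ 8 * (16 * (2 * (d : ℝ) + 1) ^ 2 * (L : ℝ) ^ 2 * A ^ 2 / ((L : ℝ) * s) ^ 2) := by gcongr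
      _ = 128 * (2 * (d : ℝ) + 1) ^ 2 * (L : ℝ) ^ 2 * A ^ 2 / ((L : ℝ) * s) ^ 2 := by ring
  -- assemble
  have hsum : a₀ + 2 * (d * ((L - 1 : ℕ) * δ)) + 2 * (d * (((L - 1 : ℕ) * L) * δ))
      + 8 * (d * ((L - 1 : ℕ) * a₀) + d * (((L - 1 : ℕ) * L) * a₀) + L * L * a₀) ^ 2
      ≤ 4 * A / ((L : ℝ) * s) ^ 2 + 48 * d * (L : ℝ) ^ 2 * G₀ / ((L : ℝ) * s) ^ 2
        + 128 * (2 * (d : ℝ) + 1) ^ 2 * (L : ℝ) ^ 2 * A ^ 2 / ((L : ℝ) * s) ^ 2 := by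
    rw [add_assoc a₀]; exact add_le_add (add_le_add ha0v.le hg2) hg3
  calc _ = a₀ + 2 * (d * ((L - 1 : ℕ) * δ)) + 2 * (d * (((L - 1 : ℕ) * L) * δ))
        + 8 * (d * ((L - 1 : ℕ) * a₀) + d * (((L - 1 : ℕ) * L) * a₀) + L * L * a₀) ^ 2 := by
          rw [ha0def, hδdef, hAdef]
    _ ≤ _ := hsum
    _ = _ := by rw [hAdef]; field_simp

/-! ## §2 The small-field clause of the filling -/

/-- **`hfillS` DISCHARGED**: for a class-`j` datum `U` with sup-form regularity `RegularSup d L N b c j U`, `0 ≤ b`, `0 ≤ c`,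
`1 ≤ d`, `(d−1)b ≤ 1/32`, `(8d−7)b ≤ 1/4`, the filled pre-compensated configuration
`W = fullFill L (precomp L U) (rootH L (precomp L U))` has
`SmallField W ((4(8d−7)b + 48dL²((2d−1)c + gradRem(d)b²) + 128(2d+1)²L²(8d−7)²b²)/(L^{j+1})²)` — leaf-07's
`smallField_fullFill` at the root data of part 2b's `rootData_precomp`, then §1. [folklore] -/
theorem smallField_fill_of_regularSup [Nonempty n] (hd1 : 1 ≤ d) {L N : ℕ} (hL : 1 ≤ L) {b c : ℝ} (hb : 0 ≤ b)
    (hc : 0 ≤ c) (hdb : ((d : ℝ) - 1) * b ≤ 1 / 32) (hdT : (8 * (d : ℝ) - 7) * b ≤ 1 / 4) {j : ℕ}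
    {U : B7Prop1Explicit.Site d → Fin d → (Matrix n n ℂ)ˣ} (hreg : RegularSup d L N b c j U) :
    SmallField (fullFill L (precomp L U) (rootH L (precomp L U)))
      ((4 * (8 * (d : ℝ) - 7) * b + 48 * d * (L : ℝ) ^ 2 * ((2 * (d : ℝ) - 1) * c + gradRem d * b ^ 2)
        + 128 * (2 * (d : ℝ) + 1) ^ 2 * (L : ℝ) ^ 2 * ((8 * (d : ℝ) - 7) * b) ^ 2) / ((L : ℝ) ^ (j + 1)) ^ 2) := by
  have hL1 : (1 : ℝ) ≤ L := by exact_mod_cast hL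
  have hd1' : (1 : ℝ) ≤ d := by exact_mod_cast hd1
  obtain ⟨hTu, hTa, hTδ⟩ := rootData_precomp hL hreg.unitary hb j hreg.small hreg.grad hdb hdT
  have hs1 : (1 : ℝ) ≤ (L : ℝ) ^ j := one_le_pow₀ hL1
  have hsmallT : (8 * (d : ℝ) - 7) * (b / ((L : ℝ) ^ j) ^ 2) ≤ 1 / 4 := by
    have h87 : 0 ≤ 8 * (d : ℝ) - 7 := by linarith
    calc (8 * (d : ℝ) - 7) * (b / ((L : ℝ) ^ j) ^ 2) ≤ (8 * (d : ℝ) - 7) * b := by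
          apply mul_le_mul_of_nonneg_left (div_le_self hb (one_le_pow₀ hs1)) h87
      _ ≤ 1 / 4 := hdT
  have hD := skeletonDatum_precomp_of_regularSup (d := d) hL hb hreg hsmallT
  have hA0 : 0 ≤ (8 * (d : ℝ) - 7) * b := by nlinarith
  have hG0 : 0 ≤ (2 * (d : ℝ) - 1) * c + gradRem d * b ^ 2 :=
    add_nonneg (mul_nonneg (by linarith) hc) (mul_nonneg (gradRem_nonneg hd1) (sq_nonneg b))
  have ha0 : 0 ≤ rootCoeff L * (4 * ((8 * (d : ℝ) - 7) * b / ((L : ℝ) ^ j) ^ 2)) :=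
    mul_nonneg (rootCoeff_nonneg L) (mul_nonneg (by norm_num) (div_nonneg hA0 (by positivity)))
  have hδ0 : 0 ≤ 12 * rootCoeff L * (((2 * (d : ℝ) - 1) * c + gradRem d * b ^ 2) / ((L : ℝ) ^ j) ^ 3) :=
    mul_nonneg (mul_nonneg (by norm_num) (rootCoeff_nonneg L)) (div_nonneg hG0 (by positivity))
  have hS := smallField_fullFill (d := d) hL hTu
    (fun z κ ν => rootH_mem_unitary hTu z κ ν (hD.small_all z κ ν)) hTa ha0 hTδ hδ0
    (fun z κ ι _ => rootH_pow hL _ z κ ι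
      (lt_of_le_of_lt (hD.small_all z κ ι) (by linarith [hsmallT])))
  have hscale := scale_fillS d L hL (s := (L : ℝ) ^ j) hs1 hA0 hG0
  rw [show ((L : ℝ) ^ (j + 1)) = (L : ℝ) * (L : ℝ) ^ j by ring]
  exact MinimalActionRate.SmallField.mono hS hscale

/-! ## §3 Part 2 with the small-field clause discharged -/

/-- **LEAF R1 ASSEMBLED MODULO THE FLUX-GRADIENT CLAUSE OF THE FILLING ONLY**: `approxRefine_of_fillBounds` with `hfillS`
discharged by §2 at `b₁ := 4(8d−7)b + 48dL²((2d−1)c + gradRem(d)b²) + 128(2d+1)²L²(8d−7)²b²`; the one remaining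
hypothesis `hfillG` is row S4d's flux-gradient bound (F4) read through `rootData_precomp`. [folklore] -/
theorem approxRefine_of_gradBound [Nonempty n] (hd1 : 1 ≤ d) (L N : ℕ) (hL : 1 ≤ L) {ε b c c₁ : ℝ}
    (hb : 0 ≤ b) (hc : 0 ≤ c) (hc₁ : 0 ≤ c₁)
    (h16 : (8 * (d : ℝ) - 7) * b ≤ 1 / 16) (hdb : ((d : ℝ) - 1) * b ≤ 1 / 32)
    (hquarter : 2 * (precompCoeff L * (((d : ℝ) - 1) * c)) + 37 * (((d : ℝ) - 1) * b) ^ 2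
      + 4 * b * (((d : ℝ) - 1) * b) ≤ 1 / 4)
    (h512 : 512 * (d + 1) * (d + 4) * (L : ℝ) ^ 2
      * (4 * (8 * (d : ℝ) - 7) * b + 48 * d * (L : ℝ) ^ 2 * ((2 * (d : ℝ) - 1) * c + gradRem d * b ^ 2)
        + 128 * (2 * (d : ℝ) + 1) ^ 2 * (L : ℝ) ^ 2 * ((8 * (d : ℝ) - 7) * b) ^ 2) ≤ 1)
    (hfillG : ∀ (j : ℕ) (U : B7Prop1Explicit.Site d → Fin d → (Matrix n n ℂ)ˣ), U ∈ sfClass (d := d) L N ε j →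
      RegularSup d L N b c j U → ∀ (x : B7Prop1Explicit.Site d) (κ : Fin d) (π : T4AveragingDeficitWall.Plane d),
      ‖covGrad (fullFill L (precomp L U) (rootH L (precomp L U)))
          (flux (fullFill L (precomp L U) (rootH L (precomp L U)))) x κ π‖ ≤ c₁ / ((L : ℝ) ^ (j + 1)) ^ 3) :
    ApproxRefine d (sfClass (d := d) (n := n) L N ε) L N b c
      (4 * (8 * (d : ℝ) - 7) * b + 48 * d * (L : ℝ) ^ 2 * ((2 * (d : ℝ) - 1) * c + gradRem d * b ^ 2)
        + 128 * (2 * (d : ℝ) + 1) ^ 2 * (L : ℝ) ^ 2 * ((8 * (d : ℝ) - 7) * b) ^ 2) c₁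
      (3 * (1280 * d * ((d : ℝ) + 1) ^ 2 * ((d : ℝ) + 4) ^ 2 * (L : ℝ) ^ 2
          * (4 * (8 * (d : ℝ) - 7) * b + 48 * d * (L : ℝ) ^ 2 * ((2 * (d : ℝ) - 1) * c + gradRem d * b ^ 2)
            + 128 * (2 * (d : ℝ) + 1) ^ 2 * (L : ℝ) ^ 2 * ((8 * (d : ℝ) - 7) * b) ^ 2) ^ 2
        + d * ((d : ℝ) + 1) * c₁ + ((d : ℝ) - 1) ^ 2 * (c + (37 * ((d : ℝ) - 1) + 4) * b ^ 2))) := by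
  have hd1' : (1 : ℝ) ≤ d := by exact_mod_cast hd1
  have hdT : (8 * (d : ℝ) - 7) * b ≤ 1 / 4 := h16.trans (by norm_num)
  have hhalf : ((d : ℝ) - 1) * b ≤ 1 / 2 := hdb.trans (by norm_num)
  have hb₁ : 0 ≤ 4 * (8 * (d : ℝ) - 7) * b + 48 * d * (L : ℝ) ^ 2 * ((2 * (d : ℝ) - 1) * c + gradRem d * b ^ 2)
      + 128 * (2 * (d : ℝ) + 1) ^ 2 * (L : ℝ) ^ 2 * ((8 * (d : ℝ) - 7) * b) ^ 2 := by
    have hG0 : 0 ≤ (2 * (d : ℝ) - 1) * c + gradRem d * b ^ 2 :=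
      add_nonneg (mul_nonneg (by linarith) hc) (mul_nonneg (gradRem_nonneg hd1) (sq_nonneg b))
    have hA0 : 0 ≤ (8 * (d : ℝ) - 7) * b := mul_nonneg (by linarith) hb
    have h1 : 0 ≤ 4 * (8 * (d : ℝ) - 7) * b := by linarith
    have h2 : 0 ≤ 48 * d * (L : ℝ) ^ 2 * ((2 * (d : ℝ) - 1) * c + gradRem d * b ^ 2) := by positivity
    have h3 : 0 ≤ 128 * (2 * (d : ℝ) + 1) ^ 2 * (L : ℝ) ^ 2 * ((8 * (d : ℝ) - 7) * b) ^ 2 := by positivity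
    linarith
  exact approxRefine_of_fillBounds hd1 L N hL hb hc hb₁ hc₁ h16 hhalf hquarter h512
    (fun j U _ hreg => smallField_fill_of_regularSup hd1 hL hb hc hdb hdT hreg) hfillG

end

end Summit.QuantumFields.BalabanUV.T4Continuum.ApproxRefineFillSmall
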